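import Literature.MathematicalPhysics.QuantumFieldTheory.SU2LinkGluingRules
import Literature.Probability.LatticeModels.ProductMeasureTools
import HarnessLib

/-!
# `SU(2)` gluing on the lattice: one-link integration with spectators, the tube and the square

Support file for the `S28ᵀ` one-bit certification (item 8941 lane; seat ym-dw-p1 g6). The landed
door `S28OneBitFiniteVolume.gapCore_eventually_of_freeCoefficient_of_forall` reduces the island gap
core of the torus–axial re-typing of Chatterjee's Problem 5.1 to ONE non-zero Taylor coefficient of
the free-boundary truncated correlation of the perpendicular pair `Q_0^{(12)}, P_{e₀}^{(01)}`; the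
pre-registered candidate is the order-8 coefficient, whose surviving diagram is the box
`∂([0,2]_0 × [0,1]_1 × [0,1]_2)` with Haar integral `2⁻⁸` for `SU(2)`. This file supplies the lattice
form of the `SU(2)` gluing rules of `Literature…SU2LinkGluingRules` (Creutz, *Quarks, Gluons and
Lattices*, Ch. 8):

* `integral_zdHaar_eq_integral_update` — integrating out one link of the product Haar measure
  `zdHaar d G` (Banach-valued form of `integral_infinitePi_eq_integral_update`);
* `integrable_zdHaar_of_continuous` — continuous functions on the compact configuration space of
  `SU(2)` are integrable; `continuous_trace_coe`;
* `integral_zdHaar_merge` / `integral_zdHaar_split` — merge `∫ Φ tr(A U_ℓ) tr(U_ℓ⁻¹ B) = ½ ∫ Φ tr(AB)`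
  and split `∫ Φ tr(A U_ℓ B U_ℓ⁻¹) = ½ ∫ Φ tr A tr B` along one link with spectators;
* `integral_cylinder` — integrating the four vertical links of a tube of four temporal plaquettes
  gives `(1/16) tr(bottom loop) tr(top loop)` (three merges, one split);
* `integral_trace_sq` — `∫ Φ tr(loop)² = ∫ Φ` (one merge).

The sequel `ChatterjeeMassGapTorusAxialOneBitBoxIntegral` evaluates the box. HONEST FRAMING: pure
Haar-measure identities; no statement about any Gibbs state, no mass gap, no summit conjunct.
-/

namespace Summit.QuantumFields.YangMills.Theorems.S28OneBitBox

open MeasureTheory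
open Literature.MathematicalPhysics.QuantumFieldTheory

noncomputable section

/-! ### One link of the lattice: merge and split with spectators

On the configuration space `ZdGaugeConfig d SU(2) = (ZdEdge d → SU(2))` with the infinite product
Haar measure `zdHaar`, a factor that does not depend on the link `ℓ` passes through the
`ℓ`-integration (`integral_infinitePi_eq_integral_update`), so the one-link rules apply link by
link inside a product of plaquette traces. -/

section Lattice

variable {d : ℕ}

/-- **Integrating out one link** (Banach-valued version of
`integral_infinitePi_eq_integral_update`): for an integrable `F` on the configuration space of a
compact group `G`, `∫ F dν = ∫ (∫ F(U with U_ℓ := g) dg) dν(U)`. -/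
theorem integral_zdHaar_eq_integral_update {G : Type*} [Group G] [TopologicalSpace G]
    [IsTopologicalGroup G] [CompactSpace G] [MeasurableSpace G] [BorelSpace G]
    {E : Type*} [NormedAddCommGroup E] [NormedSpace ℝ E] (ℓ : ZdEdge d)
    {F : ZdGaugeConfig d G → E} (hF : Integrable F (zdHaar d G)) :
    ∫ U, F U ∂zdHaar d G = ∫ U, ∫ g, F (Function.update U ℓ g) ∂haarProbability G ∂zdHaar d G := by
  classical
  unfold zdHaar at hF ⊢
  set μ : ZdEdge d → Measure G := fun _ => haarProbability G
  have hmeas : Measurable fun p : (ZdGaugeConfig d G) × G => Function.update p.1 ℓ p.2 :=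
    measurable_update'
  have hmap := Literature.Probability.LatticeModels.map_update_infinitePi_prod μ ℓ
  have hFm : AEStronglyMeasurable F (((Measure.infinitePi μ).prod (μ ℓ)).map
      fun p : (ZdGaugeConfig d G) × G => Function.update p.1 ℓ p.2) := by
    rw [hmap]; exact hF.aestronglyMeasurable
  have hint : Integrable (fun p : (ZdGaugeConfig d G) × G => F (Function.update p.1 ℓ p.2))
      ((Measure.infinitePi μ).prod (μ ℓ)) :=
    (integrable_map_measure hFm hmeas.aemeasurable).1 (by rw [hmap]; exact hF)
  calc ∫ x, F x ∂Measure.infinitePi μ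
      = ∫ x, F x ∂(((Measure.infinitePi μ).prod (μ ℓ)).map
          fun p : (ZdGaugeConfig d G) × G => Function.update p.1 ℓ p.2) := by rw [hmap]
    _ = ∫ p, F (Function.update p.1 ℓ p.2) ∂((Measure.infinitePi μ).prod (μ ℓ)) :=
        integral_map hmeas.aemeasurable hFm
    _ = ∫ x, ∫ y, F (Function.update x ℓ y) ∂μ ℓ ∂Measure.infinitePi μ := integral_prod _ hint

/-- Continuous functions on the compact configuration space of `SU(2)` are integrable for the
product Haar measure (`SU(2) ⊆ M₂(ℂ)` is second countable, so the product σ-algebra on the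
countable product is the Borel σ-algebra). -/
theorem integrable_zdHaar_of_continuous
    {F : ZdGaugeConfig d (Matrix.specialUnitaryGroup (Fin 2) ℂ) → ℂ} (hF : Continuous F) :
    Integrable F (zdHaar d (Matrix.specialUnitaryGroup (Fin 2) ℂ)) := by
  haveI : SecondCountableTopology (Matrix (Fin 2) (Fin 2) ℂ) :=
    inferInstanceAs (SecondCountableTopology (Fin 2 → Fin 2 → ℂ))
  haveI : SecondCountableTopology (Matrix.specialUnitaryGroup (Fin 2) ℂ) :=
    TopologicalSpace.Subtype.secondCountableTopology _
  haveI : OpensMeasurableSpace (ZdGaugeConfig d (Matrix.specialUnitaryGroup (Fin 2) ℂ)) :=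
    inferInstance
  haveI : IsProbabilityMeasure (zdHaar d (Matrix.specialUnitaryGroup (Fin 2) ℂ)) := by
    unfold zdHaar; infer_instance
  exact hF.integrable_of_hasCompactSupport (HasCompactSupport.of_compactSpace _)

/-- The trace of (the matrix of) a continuously varying element of `SU(2)` is continuous. -/
theorem continuous_trace_coe {X : Type*} [TopologicalSpace X]
    {f : X → Matrix.specialUnitaryGroup (Fin 2) ℂ} (hf : Continuous f) :
    Continuous fun x => ((f x : Matrix.specialUnitaryGroup (Fin 2) ℂ) : Matrix (Fin 2) (Fin 2) ℂ).trace :=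
  (continuous_subtype_val.comp hf).matrix_trace

/-- **Merge along one link of the lattice.** If `Φ`, `A`, `B` do not depend on the link variable
`U_ℓ`, then `∫ Φ · tr(A U_ℓ) tr(U_ℓ⁻¹ B) dν = ½ ∫ Φ · tr(A B) dν` for the product Haar measure
`ν = zdHaar d SU(2)`. -/
theorem integral_zdHaar_merge (ℓ : ZdEdge d)
    {F Φ : ZdGaugeConfig d (Matrix.specialUnitaryGroup (Fin 2) ℂ) → ℂ}
    {A B : ZdGaugeConfig d (Matrix.specialUnitaryGroup (Fin 2) ℂ) → Matrix (Fin 2) (Fin 2) ℂ}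
    (hF : ∀ U, F U = Φ U * ((A U * ((U ℓ : Matrix.specialUnitaryGroup (Fin 2) ℂ) :
      Matrix (Fin 2) (Fin 2) ℂ)).trace * ((((U ℓ)⁻¹ : Matrix.specialUnitaryGroup (Fin 2) ℂ) :
        Matrix (Fin 2) (Fin 2) ℂ) * B U).trace))
    (hΦ : ∀ U g, Φ (Function.update U ℓ g) = Φ U) (hA : ∀ U g, A (Function.update U ℓ g) = A U)
    (hB : ∀ U g, B (Function.update U ℓ g) = B U)
    (hFi : Integrable F (zdHaar d (Matrix.specialUnitaryGroup (Fin 2) ℂ))) :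
    ∫ U, F U ∂zdHaar d (Matrix.specialUnitaryGroup (Fin 2) ℂ) =
      1 / 2 * ∫ U, Φ U * (A U * B U).trace ∂zdHaar d (Matrix.specialUnitaryGroup (Fin 2) ℂ) := by
  classical
  rw [integral_zdHaar_eq_integral_update ℓ hFi, ← integral_const_mul]
  refine integral_congr_ae (Filter.Eventually.of_forall fun U => ?_)
  simp only [hF, hΦ, hA, hB, Function.update_self]
  rw [integral_const_mul, SU2Gluing.integral_trace_mul_mul_trace_inv_mul]
  ring

/-- **Split along one link of the lattice.** If `Φ`, `A`, `B` do not depend on the link variable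
`U_ℓ`, then `∫ Φ · tr(A U_ℓ B U_ℓ⁻¹) dν = ½ ∫ Φ · tr(A) tr(B) dν` for `ν = zdHaar d SU(2)`. -/
theorem integral_zdHaar_split (ℓ : ZdEdge d)
    {F Φ : ZdGaugeConfig d (Matrix.specialUnitaryGroup (Fin 2) ℂ) → ℂ}
    {A B : ZdGaugeConfig d (Matrix.specialUnitaryGroup (Fin 2) ℂ) → Matrix (Fin 2) (Fin 2) ℂ}
    (hF : ∀ U, F U = Φ U * (A U * ((U ℓ : Matrix.specialUnitaryGroup (Fin 2) ℂ) :
      Matrix (Fin 2) (Fin 2) ℂ) * B U * (((U ℓ)⁻¹ : Matrix.specialUnitaryGroup (Fin 2) ℂ) :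
        Matrix (Fin 2) (Fin 2) ℂ)).trace)
    (hΦ : ∀ U g, Φ (Function.update U ℓ g) = Φ U) (hA : ∀ U g, A (Function.update U ℓ g) = A U)
    (hB : ∀ U g, B (Function.update U ℓ g) = B U)
    (hFi : Integrable F (zdHaar d (Matrix.specialUnitaryGroup (Fin 2) ℂ))) :
    ∫ U, F U ∂zdHaar d (Matrix.specialUnitaryGroup (Fin 2) ℂ) =
      1 / 2 * ∫ U, Φ U * ((A U).trace * (B U).trace) ∂zdHaar d (Matrix.specialUnitaryGroup (Fin 2) ℂ) := by
  classical
  rw [integral_zdHaar_eq_integral_update ℓ hFi, ← integral_const_mul]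
  refine integral_congr_ae (Filter.Eventually.of_forall fun U => ?_)
  simp only [hF, hΦ, hA, hB, Function.update_self]
  rw [integral_const_mul, SU2Gluing.integral_trace_mul_mul_mul_inv]
  ring

end Lattice

/-! ### The cylinder and the square -/

section Cylinder

variable {d : ℕ}

/-- **The cylinder (tube) integral.** Integrating the four «vertical» links `v₁ … v₄` of the
four temporal faces of a tube `□ × [t, t+1]` glues them into `(1/16) · tr(bottom loop) · tr(top loop)`:
three merges and one split of the `SU(2)` gluing rules, in the presence of any continuous
spectator `Φ` not depending on the vertical links. Links: bottom square `b₁ b₂ b₃⁻¹ b₄⁻¹`, top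
square `m₁ m₂ m₃⁻¹ m₄⁻¹`, faces `v₁ m₁ v₂⁻¹ b₁⁻¹`, `v₃ m₃ v₄⁻¹ b₃⁻¹`, `v₁ m₄ v₃⁻¹ b₄⁻¹`,
`v₂ m₂ v₄⁻¹ b₂⁻¹` (the holonomies of `(x;0,1)`, `(x+e₂;0,1)`, `(x;0,2)`, `(x+e₁;0,2)`). -/
theorem integral_cylinder (v1 v2 v3 v4 m1 m2 m3 m4 b1 b2 b3 b4 : ZdEdge d)
    (h_v1_v2 : v1 ≠ v2) (h_v1_v3 : v1 ≠ v3) (h_v1_v4 : v1 ≠ v4) (h_v1_m1 : v1 ≠ m1)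
    (h_v1_m2 : v1 ≠ m2) (h_v1_m3 : v1 ≠ m3) (h_v1_m4 : v1 ≠ m4) (h_v1_b1 : v1 ≠ b1)
    (h_v1_b2 : v1 ≠ b2) (h_v1_b3 : v1 ≠ b3) (h_v1_b4 : v1 ≠ b4) (h_v2_v3 : v2 ≠ v3)
    (h_v2_v4 : v2 ≠ v4) (h_v2_m1 : v2 ≠ m1) (h_v2_m2 : v2 ≠ m2) (h_v2_m3 : v2 ≠ m3)
    (h_v2_m4 : v2 ≠ m4) (h_v2_b1 : v2 ≠ b1) (h_v2_b2 : v2 ≠ b2) (h_v2_b3 : v2 ≠ b3)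
    (h_v2_b4 : v2 ≠ b4) (h_v3_v4 : v3 ≠ v4) (h_v3_m1 : v3 ≠ m1) (h_v3_m2 : v3 ≠ m2)
    (h_v3_m3 : v3 ≠ m3) (h_v3_m4 : v3 ≠ m4) (h_v3_b1 : v3 ≠ b1) (h_v3_b2 : v3 ≠ b2)
    (h_v3_b3 : v3 ≠ b3) (h_v3_b4 : v3 ≠ b4) (h_v4_m1 : v4 ≠ m1) (h_v4_m2 : v4 ≠ m2)
    (h_v4_m3 : v4 ≠ m3) (h_v4_m4 : v4 ≠ m4) (h_v4_b1 : v4 ≠ b1) (h_v4_b2 : v4 ≠ b2)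
    (h_v4_b3 : v4 ≠ b3) (h_v4_b4 : v4 ≠ b4)
    (Φ : ZdGaugeConfig d ↥(Matrix.specialUnitaryGroup (Fin 2) ℂ) → ℂ) (hΦc : Continuous Φ)
    (hΦ1 : ∀ U g, Φ (Function.update U v1 g) = Φ U) (hΦ2 : ∀ U g, Φ (Function.update U v2 g) = Φ U)
    (hΦ3 : ∀ U g, Φ (Function.update U v3 g) = Φ U) (hΦ4 : ∀ U g, Φ (Function.update U v4 g) = Φ U) :
    ∫ U, Φ U * ((U v1 * U m1 * (U v2)⁻¹ * (U b1)⁻¹).1.trace *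
      (U v3 * U m3 * (U v4)⁻¹ * (U b3)⁻¹).1.trace *
      (U v1 * U m4 * (U v3)⁻¹ * (U b4)⁻¹).1.trace *
      (U v2 * U m2 * (U v4)⁻¹ * (U b2)⁻¹).1.trace) ∂zdHaar d ↥(Matrix.specialUnitaryGroup (Fin 2) ℂ) =
    1 / 16 * ∫ U, Φ U * ((U b1 * U b2 * (U b3)⁻¹ * (U b4)⁻¹).1.trace *
      (U m1 * U m2 * (U m3)⁻¹ * (U m4)⁻¹).1.trace) ∂zdHaar d ↥(Matrix.specialUnitaryGroup (Fin 2) ℂ) := by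
  classical
  -- Step 1: merge along `v1` (faces 1 and 3).
  have step1 : ∫ U, Φ U * ((U v1 * U m1 * (U v2)⁻¹ * (U b1)⁻¹).1.trace * (U v3 * U m3 * (U v4)⁻¹ *
      (U b3)⁻¹).1.trace * (U v1 * U m4 * (U v3)⁻¹ * (U b4)⁻¹).1.trace * (U v2 * U m2 * (U v4)⁻¹ *
      (U b2)⁻¹).1.trace) ∂zdHaar d ↥(Matrix.specialUnitaryGroup (Fin 2) ℂ) =
      1 / 2 * ∫ U, Φ U * ((U v3 * U m3 * (U v4)⁻¹ * (U b3)⁻¹).1.trace * (U v2 * U m2 * (U v4)⁻¹ *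
          (U b2)⁻¹).1.trace) * ((U m1 * (U v2)⁻¹ * (U b1)⁻¹).1 * (U b4 * U v3 *
          (U m4)⁻¹).1).trace ∂zdHaar d ↥(Matrix.specialUnitaryGroup (Fin 2) ℂ) := by
    have r1 : ∀ U : ZdGaugeConfig d ↥(Matrix.specialUnitaryGroup (Fin 2) ℂ), (U v1 * U m1 * (U v2)⁻¹ *
        (U b1)⁻¹).1.trace =
        ((U m1 * (U v2)⁻¹ * (U b1)⁻¹).1 * (U v1).1).trace := by
      intro U
      simp only [Submonoid.coe_mul, Matrix.mul_assoc]
      conv_lhs =>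
        rw [Matrix.trace_mul_comm]; simp only [Matrix.mul_assoc]
    have r3 : ∀ U : ZdGaugeConfig d ↥(Matrix.specialUnitaryGroup (Fin 2) ℂ), (U v1 * U m4 * (U v3)⁻¹ *
        (U b4)⁻¹).1.trace =
        ((U v1)⁻¹.1 * (U b4 * U v3 * (U m4)⁻¹).1).trace := by
      intro U
      rw [← SU2Gluing.trace_coe_inv (U v1 * U m4 * (U v3)⁻¹ * (U b4)⁻¹)]
      simp only [_root_.mul_inv_rev, inv_inv]
      simp only [Submonoid.coe_mul, Matrix.mul_assoc]
      conv_lhs =>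
        rw [Matrix.trace_mul_comm]; simp only [Matrix.mul_assoc]
        rw [Matrix.trace_mul_comm]; simp only [Matrix.mul_assoc]
        rw [Matrix.trace_mul_comm]; simp only [Matrix.mul_assoc]
    refine integral_zdHaar_merge v1 (Φ := fun U => Φ U * ((U v3 * U m3 * (U v4)⁻¹ * (U b3)⁻¹).1.trace * (U v2 *
        U m2 * (U v4)⁻¹ * (U b2)⁻¹).1.trace))
      (A := fun U => (U m1 * (U v2)⁻¹ * (U b1)⁻¹).1) (B := fun U => (U b4 * U v3 * (U m4)⁻¹).1) ?_ ?_ ?_ ?_ ?_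
    · intro U; rw [r1 U, r3 U]; ring
    · intro U g; simp only [hΦ1 U g, Function.update_of_ne (Ne.symm h_v1_v2),
        Function.update_of_ne (Ne.symm h_v1_v3), Function.update_of_ne (Ne.symm h_v1_v4),
        Function.update_of_ne (Ne.symm h_v1_m2), Function.update_of_ne (Ne.symm h_v1_m3),
        Function.update_of_ne (Ne.symm h_v1_b2), Function.update_of_ne (Ne.symm h_v1_b3)]
    · intro U g; simp only [Function.update_of_ne (Ne.symm h_v1_v2), Function.update_of_ne (Ne.symm h_v1_m1),
        Function.update_of_ne (Ne.symm h_v1_b1)]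
    · intro U g; simp only [Function.update_of_ne (Ne.symm h_v1_v3), Function.update_of_ne (Ne.symm h_v1_m4),
        Function.update_of_ne (Ne.symm h_v1_b4)]
    · exact integrable_zdHaar_of_continuous (by fun_prop)
  -- Step 2: merge along `v2` (face 4 and the merged word of step 1).
  have step2 : ∫ U, Φ U * ((U v3 * U m3 * (U v4)⁻¹ * (U b3)⁻¹).1.trace * (U v2 * U m2 * (U v4)⁻¹ *
      (U b2)⁻¹).1.trace) * ((U m1 * (U v2)⁻¹ * (U b1)⁻¹).1 * (U b4 * U v3 *
      (U m4)⁻¹).1).trace ∂zdHaar d ↥(Matrix.specialUnitaryGroup (Fin 2) ℂ) =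
      1 / 2 * ∫ U, Φ U * (U v3 * U m3 * (U v4)⁻¹ * (U b3)⁻¹).1.trace * ((U m2 * (U v4)⁻¹ * (U b2)⁻¹).1 * ((U b1)⁻¹ *
          U b4 * U v3 * (U m4)⁻¹ * U m1).1).trace ∂zdHaar d ↥(Matrix.specialUnitaryGroup (Fin 2) ℂ) := by
    have r4 : ∀ U : ZdGaugeConfig d ↥(Matrix.specialUnitaryGroup (Fin 2) ℂ), (U v2 * U m2 * (U v4)⁻¹ *
        (U b2)⁻¹).1.trace =
        ((U m2 * (U v4)⁻¹ * (U b2)⁻¹).1 * (U v2).1).trace := by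
      intro U
      simp only [Submonoid.coe_mul, Matrix.mul_assoc]
      conv_lhs =>
        rw [Matrix.trace_mul_comm]; simp only [Matrix.mul_assoc]
    have rw1 : ∀ U : ZdGaugeConfig d ↥(Matrix.specialUnitaryGroup (Fin 2) ℂ), ((U m1 * (U v2)⁻¹ * (U b1)⁻¹).1 *
        (U b4 * U v3 * (U m4)⁻¹).1).trace =
        ((U v2)⁻¹.1 * ((U b1)⁻¹ * U b4 * U v3 * (U m4)⁻¹ * U m1).1).trace := by
      intro U
      simp only [Submonoid.coe_mul, Matrix.mul_assoc]
      conv_lhs =>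
        rw [Matrix.trace_mul_comm]; simp only [Matrix.mul_assoc]
    refine integral_zdHaar_merge v2 (Φ := fun U => Φ U * (U v3 * U m3 * (U v4)⁻¹ * (U b3)⁻¹).1.trace)
      (A := fun U => (U m2 * (U v4)⁻¹ * (U b2)⁻¹).1) (B := fun U => ((U b1)⁻¹ * U b4 * U v3 * (U m4)⁻¹ *
          U m1).1) ?_ ?_ ?_ ?_ ?_
    · intro U; rw [r4 U, rw1 U]; ring
    · intro U g; simp only [hΦ2 U g, Function.update_of_ne (Ne.symm h_v2_v3),
        Function.update_of_ne (Ne.symm h_v2_v4), Function.update_of_ne (Ne.symm h_v2_m3),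
        Function.update_of_ne (Ne.symm h_v2_b3)]
    · intro U g; simp only [Function.update_of_ne (Ne.symm h_v2_v4), Function.update_of_ne (Ne.symm h_v2_m2),
        Function.update_of_ne (Ne.symm h_v2_b2)]
    · intro U g; simp only [Function.update_of_ne (Ne.symm h_v2_v3), Function.update_of_ne (Ne.symm h_v2_m1),
        Function.update_of_ne (Ne.symm h_v2_m4), Function.update_of_ne (Ne.symm h_v2_b1),
        Function.update_of_ne (Ne.symm h_v2_b4)]
    · exact integrable_zdHaar_of_continuous (by fun_prop)
  -- Step 3: merge along `v3` (the merged word of step 2 and face 2).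
  have step3 : ∫ U, Φ U * (U v3 * U m3 * (U v4)⁻¹ * (U b3)⁻¹).1.trace * ((U m2 * (U v4)⁻¹ * (U b2)⁻¹).1 * ((U b1)⁻¹ *
      U b4 * U v3 * (U m4)⁻¹ * U m1).1).trace ∂zdHaar d ↥(Matrix.specialUnitaryGroup (Fin 2) ℂ) =
      1 / 2 * ∫ U, Φ U * (((U m4)⁻¹ * U m1 * U m2 * (U v4)⁻¹ * (U b2)⁻¹ * (U b1)⁻¹ * U b4).1 * (U b3 * U v4 *
          (U m3)⁻¹).1).trace ∂zdHaar d ↥(Matrix.specialUnitaryGroup (Fin 2) ℂ) := by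
    have r2 : ∀ U : ZdGaugeConfig d ↥(Matrix.specialUnitaryGroup (Fin 2) ℂ), (U v3 * U m3 * (U v4)⁻¹ *
        (U b3)⁻¹).1.trace =
        ((U v3)⁻¹.1 * (U b3 * U v4 * (U m3)⁻¹).1).trace := by
      intro U
      rw [← SU2Gluing.trace_coe_inv (U v3 * U m3 * (U v4)⁻¹ * (U b3)⁻¹)]
      simp only [_root_.mul_inv_rev, inv_inv]
      simp only [Submonoid.coe_mul, Matrix.mul_assoc]
      conv_lhs =>
        rw [Matrix.trace_mul_comm]; simp only [Matrix.mul_assoc]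
        rw [Matrix.trace_mul_comm]; simp only [Matrix.mul_assoc]
        rw [Matrix.trace_mul_comm]; simp only [Matrix.mul_assoc]
    have rw2 : ∀ U : ZdGaugeConfig d ↥(Matrix.specialUnitaryGroup (Fin 2) ℂ), ((U m2 * (U v4)⁻¹ * (U b2)⁻¹).1 *
        ((U b1)⁻¹ * U b4 * U v3 * (U m4)⁻¹ * U m1).1).trace =
        (((U m4)⁻¹ * U m1 * U m2 * (U v4)⁻¹ * (U b2)⁻¹ * (U b1)⁻¹ * U b4).1 * (U v3).1).trace := by
      intro U
      simp only [Submonoid.coe_mul, Matrix.mul_assoc]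
      conv_lhs =>
        rw [Matrix.trace_mul_comm]; simp only [Matrix.mul_assoc]
        rw [Matrix.trace_mul_comm]; simp only [Matrix.mul_assoc]
        rw [Matrix.trace_mul_comm]; simp only [Matrix.mul_assoc]
        rw [Matrix.trace_mul_comm]; simp only [Matrix.mul_assoc]
        rw [Matrix.trace_mul_comm]; simp only [Matrix.mul_assoc]
        rw [Matrix.trace_mul_comm]; simp only [Matrix.mul_assoc]
    refine integral_zdHaar_merge v3 (Φ := fun U => Φ U)
      (A := fun U => ((U m4)⁻¹ * U m1 * U m2 * (U v4)⁻¹ * (U b2)⁻¹ * (U b1)⁻¹ * U b4).1) (B := fun U => (U b3 *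
          U v4 * (U m3)⁻¹).1) ?_ ?_ ?_ ?_ ?_
    · intro U; rw [r2 U, rw2 U]; ring
    · intro U g; exact hΦ3 U g
    · intro U g; simp only [Function.update_of_ne (Ne.symm h_v3_v4), Function.update_of_ne (Ne.symm h_v3_m1),
        Function.update_of_ne (Ne.symm h_v3_m2), Function.update_of_ne (Ne.symm h_v3_m4),
        Function.update_of_ne (Ne.symm h_v3_b1), Function.update_of_ne (Ne.symm h_v3_b2),
        Function.update_of_ne (Ne.symm h_v3_b4)]
    · intro U g; simp only [Function.update_of_ne (Ne.symm h_v3_v4), Function.update_of_ne (Ne.symm h_v3_m3),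
        Function.update_of_ne (Ne.symm h_v3_b3)]
    · exact integrable_zdHaar_of_continuous (by fun_prop)
  -- Step 4: split along `v4` (traversed twice by the merged word of step 3).
  have step4 : ∫ U, Φ U * (((U m4)⁻¹ * U m1 * U m2 * (U v4)⁻¹ * (U b2)⁻¹ * (U b1)⁻¹ * U b4).1 * (U b3 * U v4 *
      (U m3)⁻¹).1).trace ∂zdHaar d ↥(Matrix.specialUnitaryGroup (Fin 2) ℂ) =
      1 / 2 * ∫ U, Φ U * (((U b2)⁻¹ * (U b1)⁻¹ * U b4 * U b3).1.trace * ((U m3)⁻¹ * (U m4)⁻¹ * U m1 *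
          U m2).1.trace) ∂zdHaar d ↥(Matrix.specialUnitaryGroup (Fin 2) ℂ) := by
    have rw3 : ∀ U : ZdGaugeConfig d ↥(Matrix.specialUnitaryGroup (Fin 2) ℂ), (((U m4)⁻¹ * U m1 * U m2 * (U v4)⁻¹ *
        (U b2)⁻¹ * (U b1)⁻¹ * U b4).1 * (U b3 * U v4 * (U m3)⁻¹).1).trace =
        (((U b2)⁻¹ * (U b1)⁻¹ * U b4 * U b3).1 * (U v4).1 * ((U m3)⁻¹ * (U m4)⁻¹ * U m1 * U m2).1 *
            (U v4)⁻¹.1).trace := by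
      intro U
      simp only [Submonoid.coe_mul, Matrix.mul_assoc]
      conv_lhs =>
        rw [Matrix.trace_mul_comm]; simp only [Matrix.mul_assoc]
        rw [Matrix.trace_mul_comm]; simp only [Matrix.mul_assoc]
        rw [Matrix.trace_mul_comm]; simp only [Matrix.mul_assoc]
        rw [Matrix.trace_mul_comm]; simp only [Matrix.mul_assoc]
    refine integral_zdHaar_split v4 (Φ := fun U => Φ U)
      (A := fun U => ((U b2)⁻¹ * (U b1)⁻¹ * U b4 * U b3).1) (B := fun U => ((U m3)⁻¹ * (U m4)⁻¹ * U m1 *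
          U m2).1) ?_ ?_ ?_ ?_ ?_
    · intro U; rw [rw3 U]
    · intro U g; exact hΦ4 U g
    · intro U g; simp only [Function.update_of_ne (Ne.symm h_v4_b1), Function.update_of_ne (Ne.symm h_v4_b2),
        Function.update_of_ne (Ne.symm h_v4_b3), Function.update_of_ne (Ne.symm h_v4_b4)]
    · intro U g; simp only [Function.update_of_ne (Ne.symm h_v4_m1), Function.update_of_ne (Ne.symm h_v4_m2),
        Function.update_of_ne (Ne.symm h_v4_m3), Function.update_of_ne (Ne.symm h_v4_m4)]
    · exact integrable_zdHaar_of_continuous (by fun_prop)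
  -- the two loops: inverse + cyclicity
  have rA : ∀ U : ZdGaugeConfig d ↥(Matrix.specialUnitaryGroup (Fin 2) ℂ), ((U b2)⁻¹ * (U b1)⁻¹ * U b4 *
      U b3).1.trace = (U b1 * U b2 * (U b3)⁻¹ * (U b4)⁻¹).1.trace := by
    intro U
    rw [← SU2Gluing.trace_coe_inv ((U b2)⁻¹ * (U b1)⁻¹ * U b4 * U b3)]
    simp only [_root_.mul_inv_rev, inv_inv]
    simp only [Submonoid.coe_mul, Matrix.mul_assoc]
    conv_lhs =>
      rw [Matrix.trace_mul_comm]; simp only [Matrix.mul_assoc]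
      rw [Matrix.trace_mul_comm]; simp only [Matrix.mul_assoc]
  have rB : ∀ U : ZdGaugeConfig d ↥(Matrix.specialUnitaryGroup (Fin 2) ℂ), ((U m3)⁻¹ * (U m4)⁻¹ * U m1 *
      U m2).1.trace = (U m1 * U m2 * (U m3)⁻¹ * (U m4)⁻¹).1.trace := by
    intro U
    simp only [Submonoid.coe_mul, Matrix.mul_assoc]
    conv_lhs =>
      rw [Matrix.trace_mul_comm]; simp only [Matrix.mul_assoc]
      rw [Matrix.trace_mul_comm]; simp only [Matrix.mul_assoc]
  rw [step1, step2, step3, step4]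
  simp_rw [rA, rB]
  ring

/-- **The square of a plaquette trace integrates to one.** For any continuous spectator `Φ`
not depending on the link `b₁`: `∫ Φ · tr(b₁b₂b₃⁻¹b₄⁻¹)² dν = ∫ Φ dν` (one merge: `tr(u) = tr(u⁻¹)`
on `SU(2)`, `∫ tr(A u) tr(u⁻¹ A⁻¹) du = tr(1)/2 = 1`). -/
theorem integral_trace_sq (b1 b2 b3 b4 : ZdEdge d) (h12 : b1 ≠ b2) (h13 : b1 ≠ b3) (h14 : b1 ≠ b4)
    (Φ : ZdGaugeConfig d ↥(Matrix.specialUnitaryGroup (Fin 2) ℂ) → ℂ) (hΦc : Continuous Φ)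
    (hΦ1 : ∀ U g, Φ (Function.update U b1 g) = Φ U) :
    ∫ U, Φ U * ((U b1 * U b2 * (U b3)⁻¹ * (U b4)⁻¹).1.trace *
      (U b1 * U b2 * (U b3)⁻¹ * (U b4)⁻¹).1.trace) ∂zdHaar d ↥(Matrix.specialUnitaryGroup (Fin 2) ℂ) = ∫ U,
          Φ U ∂zdHaar d ↥(Matrix.specialUnitaryGroup (Fin 2) ℂ) := by
  classical
  have r1 : ∀ U : ZdGaugeConfig d ↥(Matrix.specialUnitaryGroup (Fin 2) ℂ), (U b1 * U b2 * (U b3)⁻¹ *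
      (U b4)⁻¹).1.trace =
      ((U b2 * (U b3)⁻¹ * (U b4)⁻¹).1 * (U b1).1).trace := by
    intro U
    simp only [Submonoid.coe_mul, Matrix.mul_assoc]
    conv_lhs =>
      rw [Matrix.trace_mul_comm]; simp only [Matrix.mul_assoc]
  have r2 : ∀ U : ZdGaugeConfig d ↥(Matrix.specialUnitaryGroup (Fin 2) ℂ), (U b1 * U b2 * (U b3)⁻¹ *
      (U b4)⁻¹).1.trace =
      ((U b1)⁻¹.1 * (U b4 * U b3 * (U b2)⁻¹).1).trace := by
    intro U
    rw [← SU2Gluing.trace_coe_inv (U b1 * U b2 * (U b3)⁻¹ * (U b4)⁻¹)]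
    simp only [_root_.mul_inv_rev, inv_inv]
    simp only [Submonoid.coe_mul, Matrix.mul_assoc]
    conv_lhs =>
      rw [Matrix.trace_mul_comm]; simp only [Matrix.mul_assoc]
      rw [Matrix.trace_mul_comm]; simp only [Matrix.mul_assoc]
      rw [Matrix.trace_mul_comm]; simp only [Matrix.mul_assoc]
  have step : ∫ U, Φ U * ((U b1 * U b2 * (U b3)⁻¹ * (U b4)⁻¹).1.trace *
      (U b1 * U b2 * (U b3)⁻¹ * (U b4)⁻¹).1.trace) ∂zdHaar d ↥(Matrix.specialUnitaryGroup (Fin 2) ℂ) =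
      1 / 2 * ∫ U, Φ U * ((U b2 * (U b3)⁻¹ * (U b4)⁻¹).1 * (U b4 * U b3 *
          (U b2)⁻¹).1).trace ∂zdHaar d ↥(Matrix.specialUnitaryGroup (Fin 2) ℂ) := by
    refine integral_zdHaar_merge b1 (Φ := fun U => Φ U)
      (A := fun U => (U b2 * (U b3)⁻¹ * (U b4)⁻¹).1) (B := fun U => (U b4 * U b3 * (U b2)⁻¹).1) ?_ ?_ ?_ ?_ ?_
    · intro U; rw [← r1 U, ← r2 U]
    · intro U g; exact hΦ1 U g
    · intro U g
      simp only [Function.update_of_ne (Ne.symm h12), Function.update_of_ne (Ne.symm h13),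
          Function.update_of_ne (Ne.symm h14)]
    · intro U g
      simp only [Function.update_of_ne (Ne.symm h12), Function.update_of_ne (Ne.symm h13),
          Function.update_of_ne (Ne.symm h14)]
    · exact integrable_zdHaar_of_continuous (by fun_prop)
  have h1 : ∀ U : ZdGaugeConfig d ↥(Matrix.specialUnitaryGroup (Fin 2) ℂ), ((U b2 * (U b3)⁻¹ * (U b4)⁻¹).1 * (U b4 *
      U b3 * (U b2)⁻¹).1).trace = 2 := by
    intro U
    rw [← Submonoid.coe_mul]
    have : (U b2 * (U b3)⁻¹ * (U b4)⁻¹ * (U b4 * U b3 * (U b2)⁻¹) : ↥(Matrix.specialUnitaryGroup (Fin 2) ℂ)) = 1 :=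
        by group
    rw [this, Submonoid.coe_one, Matrix.trace_one, Fintype.card_fin]; norm_num
  rw [step]
  simp_rw [h1]
  rw [← integral_const_mul]
  refine integral_congr_ae (Filter.Eventually.of_forall fun U => ?_)
  ring

end Cylinder

end

end Summit.QuantumFields.YangMills.Theorems.S28OneBitBox
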